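import Literature.Algebra.Polynomial.GregoryFormula
import Mathlib.Tactic
import HarnessLib

/-!
# The Bernoulli polynomials of the second kind `b_n (x) = J (x)_n` (Rota–Kahaner–Odlyzko §13)

G.-C. Rota, D. Kahaner, A. Odlyzko, *Finite operator calculus* (1973), §13 "Difference Polynomials",
p. 742:

> They are the Sheffer sets associated with the difference operator `Δ = E − I`, having the basic
> polynomials `(x)_n = x (x − 1) ⋯ (x − n + 1)`. … The generating function of a set of difference
> polynomials can be written in the suggestive form `s (t)⁻¹ (1 + t)^x`. … The expansion of the Bernoulli
> operator `J` in powers of `Δ` is Gregory's formula. … Notable difference sets (cf. Boas and Buck) are: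
> … (e) Bernoulli polynomials of the second kind `b_n (x) = J (x)_n`, extensively studied by Jordan.

(`J p (x) = ∫_x^{x+1} p (t) dt = ((e^D − 1)/D) p`, §13 p. 737.) Typed here: the DEFINITION
`bernoulliSecondKind K n = J (x)_n = diffOp (bernoulliPowerSeries K)⁻¹ (descPochhammer K n)` (a real
definition with body) and its first properties, all proved: a Sheffer set for `Δ`
(`isShefferSequence_bernoulliSecondKind`: `Δ b_n = n b_{n−1}`, `deg b_n = n`), `b_n′ = (x)_n (x+1) − (x)_n`
read as `D b_n = Δ (x)_n = n (x)_{n−1}` (`derivative_bernoulliSecondKind_succ`), the values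
`b_n (0) = n! · G_n` with `G_n` the Gregory coefficients `[tⁿ] t/log (1 + t)` of `GregoryFormula`
(`bernoulliSecondKind_eval_zero`), and the generating function in "the suggestive form `s (t)⁻¹ (1 + t)^x`":
`Σ_n b_n (a) tⁿ/n! = (t/log (1 + t)) · (1 + t)^a` with `(1 + t)^a = e^{a log (1 + t)}`
(`egf_bernoulliSecondKind`); `b_0 = 1`, `b_1 = x + 1/2`.

## References
* [RotaKahanerOdlyzko1973] G.-C. Rota, D. Kahaner, A. Odlyzko, *On the foundations of
  combinatorial theory VIII. Finite operator calculus*, J. Math. Anal. Appl. 42 (1973) 684–760,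
  §13, pp. 737, 742.
-/

noncomputable section

open Polynomial Finset

namespace Literature.Algebra.Polynomial

variable (K : Type*) [Field K] [CharZero K]

/-- **The Bernoulli polynomials of the second kind** `b_n (x) = J (x)_n`, `J = (e^D − 1)/D` the Bernoulli
operator `J p (x) = ∫_x^{x+1} p (t) dt` and `(x)_n` the lower factorial (Jordan's normalization times `n!`).
[cite: RotaKahanerOdlyzko1973, §13 ("(e) Bernoulli polynomials of the second kind `b_n (x) = J (x)_n`"), p. 742] -/
def bernoulliSecondKind (n : ℕ) : K[X] :=
  diffOp (bernoulliPowerSeries K)⁻¹ (descPochhammer K n)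

/-- Unfolding `b_n = J (x)_n`. [cite: RotaKahanerOdlyzko1973, §13, p. 742] -/
theorem bernoulliSecondKind_eq (n : ℕ) :
    bernoulliSecondKind K n = diffOp (bernoulliPowerSeries K)⁻¹ (descPochhammer K n) :=
  rfl

/-- **`(b_n)` is a Sheffer set for `Δ`** ("difference polynomials"): `J` is an invertible composition
operator and `(x)_n` is the basic set of `Δ`. [cite: RotaKahanerOdlyzko1973, §13, p. 742] -/
theorem isShefferSequence_bernoulliSecondKind :
    IsShefferSequence (taylor (1 : K) - LinearMap.id : K[X] →ₗ[K] K[X]) (bernoulliSecondKind K) :=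
  isBasicSequence_descPochhammer.isShefferSequence_map isDeltaOperator_taylor_sub_id (isShiftInvariant_diffOp _)
    (by
      rw [diffOp_apply_one, PowerSeries.constantCoeff_inv, constantCoeff_bernoulliPowerSeries, inv_one, C_1]
      exact one_ne_zero)

/-- `Δ b_{n+1} = (n+1) b_n`. [cite: RotaKahanerOdlyzko1973, §13, p. 742] -/
theorem forwardDifference_bernoulliSecondKind_succ (n : ℕ) :
    taylor (1 : K) (bernoulliSecondKind K (n + 1)) - bernoulliSecondKind K (n + 1) =
      ((n + 1 : ℕ) : K) • bernoulliSecondKind K n := by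
  have h := (isShefferSequence_bernoulliSecondKind K).map_succ n
  rwa [LinearMap.sub_apply, LinearMap.id_apply] at h

/-- **`D b_n = Δ (x)_n`** (`D J = Δ`), i.e. `b_{n+1}′ = (n+1) (x)_n`. [cite: RotaKahanerOdlyzko1973, §13, pp. 737, 742] -/
theorem derivative_bernoulliSecondKind_succ (n : ℕ) :
    derivative (bernoulliSecondKind K (n + 1)) = ((n + 1 : ℕ) : K) • descPochhammer K n := by
  have h := LinearMap.congr_fun (derivative_comp_diffOp_bernoulliPowerSeries_inv K) (descPochhammer K (n + 1))
  rw [LinearMap.comp_apply] at h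
  rw [bernoulliSecondKind_eq, h]
  exact isBasicSequence_descPochhammer.map_succ n

/-- `b_0 = 1`. [cite: RotaKahanerOdlyzko1973, §13, p. 742] -/
theorem bernoulliSecondKind_zero : bernoulliSecondKind K 0 = 1 := by
  rw [bernoulliSecondKind_eq, descPochhammer_zero, diffOp_apply_one, PowerSeries.constantCoeff_inv,
    constantCoeff_bernoulliPowerSeries, inv_one, C_1]

/-- **`b_n (0) = n! · G_n`**, `G_n = [tⁿ] t/log (1 + t)` the Gregory coefficients: the constant terms of the
`b_n` are the coefficients of the expansion of `J` in powers of `Δ` (Gregory's formula).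
[cite: RotaKahanerOdlyzko1973, §13, p. 742] -/
theorem bernoulliSecondKind_eval_zero (n : ℕ) :
    (bernoulliSecondKind K n).eval 0 = (n.factorial : K) * PowerSeries.coeff n (logDivX K)⁻¹ := by
  have h := (isDeltaOperator_taylor_sub_id (K := K)).coeff_indicator (diffOp (bernoulliPowerSeries K)⁻¹) n
  rw [indicator_forwardDifference_J, basicSequence_taylor_sub_id] at h
  rw [bernoulliSecondKind_eq, h, mul_div_cancel₀ _ (Nat.cast_ne_zero.2 (Nat.factorial_ne_zero n))]

/-- `b_1 = x + 1/2`. [cite: RotaKahanerOdlyzko1973, §13, p. 742] -/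
theorem bernoulliSecondKind_one : bernoulliSecondKind K 1 = X + C (2⁻¹ : K) := by
  rw [bernoulliSecondKind_eq, descPochhammer_one, diffOp_apply_X, PowerSeries.constantCoeff_inv,
    constantCoeff_bernoulliPowerSeries, inv_one, one_smul]
  congr 2
  have h := bernoulliSecondKind_eval_zero K 1
  rw [bernoulliSecondKind_eq, descPochhammer_one, diffOp_apply_X, eval_add, eval_smul, eval_X, smul_zero,
    zero_add, eval_C, Nat.factorial_one, Nat.cast_one, one_mul, gregoryCoeff_one, one_div] at h
  exact h

/-- **The generating function "in the suggestive form `s (t)⁻¹ (1 + t)^x`"**: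
`Σ_n b_n (a) tⁿ/n! = (t/log (1 + t)) · (1 + t)^a`, with `t/log (1 + t) = λ(t)⁻¹` and `(1 + t)^a = e^{a log (1+t)}`
(§5 Proposition 5 for `Q = Δ`, `S⁻¹ = J`). [cite: RotaKahanerOdlyzko1973, §13, p. 742]
[cite: RotaKahanerOdlyzko1973, §5 Proposition 5, p. 702] -/
theorem egf_bernoulliSecondKind (a : K) :
    (PowerSeries.mk fun n => (bernoulliSecondKind K n).eval a / (n.factorial : K)) =
      (logDivX K)⁻¹ * (PowerSeries.rescale a (PowerSeries.exp K)).subst (PowerSeries.log K) := by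
  rw [isDeltaOperator_taylor_sub_id.egf_sheffer forwardDifference_eq_diffOp isBasicSequence_descPochhammer
      (bernoulliPowerSeries K)⁻¹ (fun n => (bernoulliSecondKind_eq K n).symm) a,
    indicator_derivative_forwardDifference,
    PowerSeries.subst_mul (PowerSeries.HasSubst.of_constantCoeff_zero' PowerSeries.constantCoeff_log),
    powerSeries_inv_subst PowerSeries.constantCoeff_log (constantCoeff_bernoulliPowerSeries_ne_zero K),
    ← logDivX_subst_exp_sub_one K, PowerSeries.subst_comp_subst_apply
      (PowerSeries.HasSubst.of_constantCoeff_zero' (constantCoeff_exp_sub_one K))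
      (PowerSeries.HasSubst.of_constantCoeff_zero' PowerSeries.constantCoeff_log),
    exp_sub_one_subst_log, PowerSeries.X_subst]

end Literature.Algebra.Polynomial
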